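import Mathlib.CategoryTheory.Endomorphism
import Mathlib.Topology.Algebra.ContinuousMonoidHom
import Literature.AnabelianGeometry.SemiGraphs.SemiGraph
import Literature.AnabelianGeometry.AbsoluteAnabelian.FundamentalExtension
import Literature.AnabelianGeometry.AbsoluteAnabelian.AbsAnabFundamentalGroups

/-!
# [AbsTopI] Thm 2.14 (Graph-theoreticity for hyperbolic curves) — the semi-graph part

S. Mochizuki, *Topics in Absolute Anabelian Geometry I* (2012) [AbsTopI] Thm 2.14 pp. 33–34
(manuscript pagination, lit key paper:url-11ac98ba15fc; "[cf. [Mzk6], Lemma 2.3, in the profinite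
case]"), cited by [IUTchII] p. 67.  Setting: for `i = 1, 2`, `1 → Δᵢ → Πᵢ → Gᵢ → 1` of AFG-type
with base field an MLF `kᵢ` of residue characteristic `pᵢ`, `Σᵢ ∋` a prime `≠ pᵢ`, `Xᵢ` a
hyperbolic curve with stable reduction over `𝒪_{kᵢ}`, `Γᵢ` "the dual semi-graph with compact
structure [i.e., the dual graph, together with additional open edges corresponding to the cusps]
of the geometric special fiber of the stable model", with its natural `Gᵢ`-action, and an
isomorphism `φ : Π₁ ≅ Π₂`.  The group part of (i) (`p₁ = p₂`, `Σ₁ = Σ₂`, `Δ₁ ≅ Δ₂`, `G₁ ≅ G₂`) is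
`Thm214GroupPart` in `AbsTopISemiAbsolute.lean`; here, over abc-iut-L3-t1's `SemiGraph`
(`Literature.AnabelianGeometry.SemiGraphs`), the graph part of (i) and (ii) as PREDICATES on
declared data (the dual semi-graph with Galois action, the combinatorial quotient `Π ↠ Δ^{com}`):
`InducesGraphIso`, `CompatibleWithCombinatorialQuotients`.  "Functorial in `φ`" (a statement about
all `φ` at once) is recorded in the docstring only.
-/

noncomputable section

open CategoryTheory

universe u

namespace Literature.AnabelianGeometry.AbsoluteAnabelian

open Literature.AnabelianGeometry.SemiGraphs

namespace FundamentalExtension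

/-- Declared data for [AbsTopI] Thm 2.14: the dual semi-graph with compact structure `Γ` of the
geometric special fibre of the stable model, with the natural action of `G` by automorphisms of
semi-graphs. [cite: MochizukiAbsTopI2012, Thm 2.14 p.33] -/
structure DualGraphData (E : FundamentalExtension.{u}) : Type (u + 1) where
  /-- the dual semi-graph with compact structure `Γ` -/
  graph : SemiGraph.{u}
  /-- the natural Galois action `G → Aut(Γ)` -/
  galAction : E.gal →* Aut graph

variable {E F : FundamentalExtension.{u}}

/-- [AbsTopI] Thm 2.14 (i), graph part, as a predicate: the isomorphism `φ : Π₁ ≅ Π₂` (carrying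
`Δ₁` onto `Δ₂`, hence inducing `φ_G : G₁ ≅ G₂`) "induces an isomorphism of semi-graphs
`φ_Γ : Γ₁ ≅ Γ₂` … In particular, the natural Galois action of `G₁` on `Γ₁` is compatible,
relative to `φ_Γ`, with the natural Galois action of `G₂` on `Γ₂`" — existence of an isomorphism
of semi-graphs intertwining the Galois actions through `φ_G`.
[cite: MochizukiAbsTopI2012, Thm 2.14 (i) p.33] -/
def InducesGraphIso (Γ₁ : DualGraphData E) (Γ₂ : DualGraphData F) (φ : E.arith ≃ₜ* F.arith)
    (hφ : PreservesGeom φ) : Prop :=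
  ∃ φΓ : Γ₁.graph ≅ Γ₂.graph, ∀ g : E.gal,
    (Γ₁.galAction g).hom ≫ φΓ.hom = φΓ.hom ≫ (Γ₂.galAction (hφ.galEquiv g)).hom

/-- The Galois action on the dual semi-graph is trivial (hypothesis of Thm 2.14 (ii)).
[cite: MochizukiAbsTopI2012, Thm 2.14 (ii) p.33] -/
def DualGraphData.TrivialAction (Γ : DualGraphData E) : Prop := ∀ g : E.gal, Γ.galAction g = 1

/-- Declared data: the pro-`Σ` "combinatorial" quotient `Π ↠ Δ^{com}` "determined by the finite
Galois coverings of the semi-graph `Γ` of degree a product of primes ∈ `Σ`"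
([AbsTopI] Thm 2.14 (ii); Thm 2.11 (iii)). [cite: MochizukiAbsTopI2012, Thm 2.14 (ii) p.33] -/
structure CombinatorialQuotient (E : FundamentalExtension.{u}) : Type (u + 1) where
  /-- `Δ^{com}` -/
  com : ProfiniteGrp.{u}
  /-- `Π ↠ Δ^{com}` -/
  proj : E.arith →ₜ* com
  /-- surjective -/
  proj_surjective : Function.Surjective proj

/-- [AbsTopI] Thm 2.14 (ii) as a predicate: when the Galois actions on `Γᵢ` are trivial, "`φ` is
compatible with the quotients `Πᵢ ↠ Δᵢ^{com}`" — `φ` carries `Ker(Π₁ ↠ Δ₁^{com})` onto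
`Ker(Π₂ ↠ Δ₂^{com})`. [cite: MochizukiAbsTopI2012, Thm 2.14 (ii) p.33] -/
def CompatibleWithCombinatorialQuotients (Q₁ : CombinatorialQuotient E) (Q₂ : CombinatorialQuotient F)
    (φ : E.arith ≃ₜ* F.arith) : Prop :=
  Q₁.proj.toMonoidHom.ker.map φ.toMulEquiv.toMonoidHom = Q₂.proj.toMonoidHom.ker

end FundamentalExtension

end Literature.AnabelianGeometry.AbsoluteAnabelian
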